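import Summits.BirchSwinnertonDyer.BirchSwinnertonDyer.Theorems.ManinLocalTwoThreeManinConstantOneThirtyFive
import Summits.BirchSwinnertonDyer.BirchSwinnertonDyer.Theorems.ManinLocalTwoThreeDyadicTwistFamiliesFactFree
import HarnessLib

/-!
# The ADDITIVE root `135` for the fact-free twist families: `LevelManinOne 135`, its odd and dyadic twist images, and the crux shapes

Cell bsd-f2-manin, route `ManinLocalTwoThree` (cruxes C2 `ManinOddAtFour` stmt-22967 / C3 `ManinPrimeToThreeAtNine` stmt-22968),
prover seat p3 gen 27; the level-`135` twin of `…TwistRootsOneHundredFive`.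
`LevelOneThirtyFive.abs_maninConstant_eq_one_oneThirtyFive` (this seat: an g54's pinning kernel + depth-`218` Bracket–Sturm certificate of
`135a` + the same-level aligned `χ₋₃`-transport to `135b` + Néron squeeze, FACT-FREE) is verbatim `LevelManinOne 135`; the tree's twist engines
(planner -desc, THEOREMS 68.A–C / 69.A–C) turn it into `|c| = 1` (hence `2 ∤ c`, `3 ∤ c`, `5 ∤ c`) on the twist images of the two classes of
conductor `135 = 3³·5` (both additive at `3` — `135a1` of Kodaira type `IV`, `135b1` of type `II*` — multiplicative at `5`, good at `2`): `135x ⊗ χ₋₄` (`N = 2160 = 2⁴·3³·5`,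
C2 AND C3), `135x ⊗ χ±8` (`8640 = 2⁶·3³·5`, C2 AND C3), `135x ⊗ χ₅` (`3375 = 3³·5³`, C3 and the residual C5 domain), and `135x ⊗ χ_p` at
`135p²` for every odd prime `p ≥ 7`.  The level is ODD, so the Stevens `η`-clause of the dyadic engine is met by `¬ 2 ∣ 135`.  (The `χ₋₃`-image is the
level itself — the two classes are each other's `χ₋₃`-twists — which is why no `p = 3` member is listed: the engines' semistability clause at `3`
is not met by an additive carrier, and that case is exactly what `…ManinConstantOneThirtyFive` settles directly.)

HONEST SCOPE.  The statements cover exactly the twist images of level `135` (hypotheses as in the engines).  Nothing here proves C2, C3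
(∀ N), the rung, Manin's conjecture or BSD; items 22967/22968 stay OPEN.  No definition, no named fact, no sorry.
[cite: Stevens1989, Lemma (5.2), (5.4), (5.6)–(5.7)] [cite: Pal2012, Prop. 2.4] [cite: CremonaAlgorithms1997, Table 1 (135a1, 135b1, 2160, 3375)]
-/

set_option autoImplicit false
-- lint-debt: the directory name repeats the summit name (sibling precedent `ManinLocalTwoThreeTwistRootsOneHundredFive.lean`)
set_option linter.dupNamespace false

noncomputable section

open Complex
open scoped MatrixGroups ModularForm
open ModularForm CongruenceSubgroup
open Literature.NumberTheory.EllipticCurves Literature.NumberTheory.EllipticCurves.ModularForms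
open Summit.BirchSwinnertonDyer.BirchSwinnertonDyer.Theorems.ManinLocalTwoThree

namespace Summit.BirchSwinnertonDyer.BirchSwinnertonDyer.Theorems.ManinLocalTwoThree.TwistRootsOneThirtyFive

open WeierstrassCurve TwistFamilies DyadicTwistFamilies

/-! ## §1 The root and its families -/

/-- **`LevelManinOne 135`** — level `135 = 3³·5` (C3 domain, `27 ∥ 135`; genus `13`; classes `135a`, `135b = 135a ⊗ χ₋₃`) is COMPLETE, fact-free
(p3 g27: Bracket–Sturm for `135a` + same-level aligned `χ₋₃`-transport for `135b`). [cite: CremonaAlgorithms1997, Table 1 (135a1, 135b1)] -/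
theorem levelManinOne_oneThirtyFive : LevelManinOne 135 :=
  fun W _ _ D h ↦ LevelOneThirtyFive.abs_maninConstant_eq_one_oneThirtyFive W D h

/-- **`TwistLevelManinOne 135 p` for every odd prime `p`** (THEOREM 68.A on the root `135`): `|c| = 1` on the `χ_p`-twist image of level `135`
(carrier good or multiplicative at `p`) — at `p = 5` the level `3375 = 3³·5³`, at `p ≥ 7` the levels `135p²`. [cite: Stevens1989, Lemma (5.2), (5.4)] -/
theorem twistLevelManinOne_oneThirtyFive {p : ℕ} [Fact p.Prime] (hp2 : p ≠ 2) : TwistLevelManinOne 135 p :=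
  twistLevelManinOne_of_levelManinOne levelManinOne_oneThirtyFive hp2

/-- **`DyadicTwistLevelManinOne 135 d`, `d ∈ {−1, 2, −2}`** (THEOREM 69.A on the root `135`): the levels `2160 = 2⁴·3³·5` (`χ₋₄`) and
`8640 = 2⁶·3³·5` (`χ±8`), both in the C2 AND the C3 domain. [cite: Stevens1989, Lemma (5.6)–(5.7)] [cite: Pal2012, Prop. 2.4] -/
theorem dyadicTwistLevelManinOne_oneThirtyFive {d : ℤ} (hd : d = -1 ∨ d = 2 ∨ d = -2) : DyadicTwistLevelManinOne 135 d :=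
  dyadicTwistLevelManinOne_of_levelManinOne levelManinOne_oneThirtyFive hd

/-- **Per-newform closure at the root `135`** (THEOREM 68.C): every `χ_p`-twist (`p` odd, the carrier good at `p`) of the newform of an
`X₀(135)`-datum has `NewformManinOne`. [cite: Stevens1989, Lemma (5.2), (5.4)] -/
theorem newformManinOne_twist_oneThirtyFive {p : ℕ} [Fact p.Prime] (hp2 : p ≠ 2)
    {χ : DirichletCharacter ℂ p} (hχ : χ.IsQuadratic) (hprim : χ.IsPrimitive)
    {W₀ : WeierstrassCurve ℚ} [W₀.IsElliptic] (D₀ : ModularParametrizationData W₀ 135)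
    (hgood : W₀.HasGoodReductionAtPrime p)
    {N : ℕ} [NeZero N] (hMN : 135 ∣ N) (hpN : p ^ 2 ∣ N) (g' : CuspForm (Gamma0 N) 2)
    (hg' : ∀ n : ℕ, cuspCoeff g' n = χ n * cuspCoeff D₀.f n) : NewformManinOne g' :=
  newformManinOne_twist_of_levelManinOne levelManinOne_oneThirtyFive hp2 hχ hprim D₀ hgood hMN hpN g' hg'

/-! ## §2 The crux shapes on named members -/

/-- **C2 ∧ C3 on `135x ⊗ χ₋₄` (level `2160 = 2⁴·3³·5`)**: `|c(D')| = 1 ∧ 2 ∤ c(D') ∧ 3 ∤ c(D')` for every lattice-optimal `X₀(2160)`-datum `D'` of a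
globally minimal `W'` additive at `2` and isogenous to the `−1`-twist of a `2`-semistable carrier of a lattice-optimal `X₀(135)`-datum.
No printed fact. [cite: CremonaAlgorithms1997, Table 1 (2160)] -/
theorem shapes_on_family_oneThirtyFive_negOne
    (W : WeierstrassCurve ℚ) [W.IsElliptic] [W.IsGloballyMinimal] (D : ModularParametrizationData W 135)
    (hopt : ∀ z ∈ D.L.lattice, ∃ w ∈ periodLattice D.f, z = D.c * w)
    (hsemi : W.HasGoodReductionAtPrime 2 ∨ W.HasMultiplicativeReductionAtPrime 2)
    (W' : WeierstrassCurve ℚ) [W'.IsElliptic] [W'.IsGloballyMinimal] [NeZero (2160 : ℕ)]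
    (D' : ModularParametrizationData W' 2160)
    (htw : IsIsogenous W' (W.quadraticTwist ((-1 : ℤ) : ℚ)))
    (hadd' : ¬ W'.HasGoodReductionAtPrime 2 ∧ ¬ W'.HasMultiplicativeReductionAtPrime 2)
    (hopt' : ∀ z ∈ D'.L.lattice, ∃ w ∈ periodLattice D'.f, z = D'.c * w) :
    |D'.maninConstant| = 1 ∧ ¬ (2 : ℤ) ∣ D'.maninConstant ∧ ¬ (3 : ℤ) ∣ D'.maninConstant :=
  shapes_of_dyadicTwistLevelManinOne (dyadicTwistLevelManinOne_oneThirtyFive (Or.inl rfl)) W D hopt hsemi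
    (Or.inl rfl) W' 2160 D' (by norm_num) (by norm_num) htw hadd' hopt'

/-- **C2 ∧ C3 on `135x ⊗ χ±8` (level `8640 = 2⁶·3³·5`)**; the level `135` is odd, so Stevens' `η`-clause needs no hypothesis at `2` beyond
`2`-semistability of the carrier. [cite: Stevens1989, Lemma (5.6)–(5.7)] -/
theorem shapes_on_family_oneThirtyFive_two {d : ℤ} (hd : d = 2 ∨ d = -2)
    (W : WeierstrassCurve ℚ) [W.IsElliptic] [W.IsGloballyMinimal] (D : ModularParametrizationData W 135)
    (hopt : ∀ z ∈ D.L.lattice, ∃ w ∈ periodLattice D.f, z = D.c * w)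
    (hsemi : W.HasGoodReductionAtPrime 2 ∨ W.HasMultiplicativeReductionAtPrime 2)
    (W' : WeierstrassCurve ℚ) [W'.IsElliptic] [W'.IsGloballyMinimal] [NeZero (8640 : ℕ)]
    (D' : ModularParametrizationData W' 8640)
    (htw : IsIsogenous W' (W.quadraticTwist (d : ℚ)))
    (hadd' : ¬ W'.HasGoodReductionAtPrime 2 ∧ ¬ W'.HasMultiplicativeReductionAtPrime 2)
    (hopt' : ∀ z ∈ D'.L.lattice, ∃ w ∈ periodLattice D'.f, z = D'.c * w) :
    |D'.maninConstant| = 1 ∧ ¬ (2 : ℤ) ∣ D'.maninConstant ∧ ¬ (3 : ℤ) ∣ D'.maninConstant :=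
  have hd3 : d = -1 ∨ d = 2 ∨ d = -2 := Or.inr hd
  have habs : (4 * d.natAbs) ^ 2 = 64 := by rcases hd with rfl | rfl <;> rfl
  shapes_of_dyadicTwistLevelManinOne (dyadicTwistLevelManinOne_oneThirtyFive hd3) W D hopt hsemi
    (Or.inr (Or.inr (Or.inr (by decide)))) W' 8640 D' (by norm_num) (by rw [habs]; norm_num) htw hadd' hopt'

/-- **C3 and the residual C5 shape on `135x ⊗ χ₅` (level `3375 = 3³·5³`)**: `|c(D')| = 1 ∧ 3 ∤ c(D') ∧ 5 ∤ c(D')` on the `5`-twist image of level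
`135` (the carrier good or multiplicative at `5`).  No printed fact. [cite: CremonaAlgorithms1997, Table 1 (3375)] -/
theorem shapes_on_family_oneThirtyFive_five [Fact (Nat.Prime 5)]
    (χ : DirichletCharacter ℂ 5) (hχ : χ.IsQuadratic) (hprim : χ.IsPrimitive)
    (W : WeierstrassCurve ℚ) [W.IsElliptic] [W.IsGloballyMinimal] (D : ModularParametrizationData W 135)
    (hopt : ∀ z ∈ D.L.lattice, ∃ w ∈ periodLattice D.f, z = D.c * w)
    (hsemi : W.HasGoodReductionAtPrime 5 ∨ W.HasMultiplicativeReductionAtPrime 5)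
    (W' : WeierstrassCurve ℚ) [W'.IsElliptic] [W'.IsGloballyMinimal] [NeZero (3375 : ℕ)]
    (D' : ModularParametrizationData W' 3375)
    (hf : ∀ n : ℕ, cuspCoeff D'.f n = χ n * cuspCoeff D.f n)
    (hopt' : ∀ z ∈ D'.L.lattice, ∃ w ∈ periodLattice D'.f, z = D'.c * w) :
    |D'.maninConstant| = 1 ∧ ¬ (3 : ℤ) ∣ D'.maninConstant ∧ ¬ (5 : ℤ) ∣ D'.maninConstant :=
  have h1 := twistLevelManinOne_oneThirtyFive (p := 5) (by norm_num) χ hχ hprim W D hopt hsemi W' 3375 D'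
    (by norm_num) (by norm_num) hf hopt'
  ⟨h1, not_dvd_of_abs_eq_one h1 (by decide), not_dvd_of_abs_eq_one h1 (by decide)⟩

end Summit.BirchSwinnertonDyer.BirchSwinnertonDyer.Theorems.ManinLocalTwoThree.TwistRootsOneThirtyFive

end
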